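import Summits.Parity.GeneralizedHardyLittlewood.Theorems.LiouvilleShiftedTablesEngineToPairsDefs
import Literature.NumberTheory.LFunctions.TaoLogChowlaMoebiusOfLiouville

/-!
# `TAvg → MAvg`, part 1: the `k²`-trick at a single height

(Stub S2 of line `Sketch`, crux `EngineToPairs`.)

Route `LiouvilleShiftedTables` (Parity / GeneralizedHardyLittlewood), crux stmt-Parity-14659.
We prove `stub_MAvg_of_TAvg : TAvg → MAvg`: the hinge (`λ` of the shifted primes in ALL progressions
`q ≤ x^ε` at a common height) implies the route's terminal parity node `MAvg`
(`∑_{m ≤ x^ε} log m · |∑_{d ≤ x/m} μ(d) Λ(dm + h)| = o(x)`).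

Proof: `μ(d) = λ(d) ∑_{k² ∣ d} μ(k)` and `λ(d) = λ(m) λ(dm)` give
`S_m := ∑_{d ≤ x/m} μ(d) Λ(dm+h) = λ(m) ∑_k μ(k) T(k² m)` with
`T(q) := ∑_{n ≤ x + h, n ≡ h (q)} Λ(n) λ(n - h)` (single height `x + h`); the terms `k ≤ K` are
controlled by `TAvg` at `x + h` (for fixed `k` the map `m ↦ k² m` is injective), the terms `k > K`
trivially by `x log x / (k² m)`; with `K ≍ (log x)^4` and `A = 6` both parts are `O(x / log x)`.

This part: the combinatorial inequality at fixed integer parameters `(X, M, K, Q)`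
(`sum_abs_slice_le`); part 2 (`…MAvgOfTAvg.lean`) does the analytic assembly and proves the stub.
-/

noncomputable section

namespace Summit.Parity.GeneralizedHardyLittlewood.Theorems.EngineToPairs

open Finset Real
open scoped ArithmeticFunction.vonMangoldt ArithmeticFunction.Moebius

/-! ### Reindexing lemmas -/

/-- The class sum at height `X + h` as a sum over the cofactor: for `q ≥ 1`,
`∑_{n ≤ X + h, n ≡ h (q)} Λ(n) λ(n - h) = ∑_{e ≤ X/q} Λ(qe + h) λ(qe)` (terms with `n ≤ h` vanish
since `λ(0) = 0`). [folklore] -/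
theorem sum_filter_modEq_eq_sum_cofactor (h q X : ℕ) (hq : 1 ≤ q) :
    ∑ n ∈ (Icc 1 (X + h)).filter (fun n : ℕ => n ≡ h [MOD q]),
        Λ n * (ArithmeticFunction.liouville (n - h) : ℝ) =
      ∑ e ∈ Icc 1 (X / q), Λ (q * e + h) * (ArithmeticFunction.liouville (q * e) : ℝ) := by
  symm
  refine Finset.sum_bij_ne_zero (fun e _ _ => q * e + h) ?_ ?_ ?_ ?_
  · intro e he _
    obtain ⟨he1, he2⟩ := mem_Icc.mp he
    have hqe : e * q ≤ X := (Nat.le_div_iff_mul_le hq).mp he2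
    have hqe' : 1 ≤ q * e := Nat.mul_pos hq he1
    refine mem_filter.mpr ⟨mem_Icc.mpr ⟨by omega, by nlinarith⟩, ?_⟩
    have hmod : q * e + h ≡ 0 + h [MOD q] :=
      (Nat.modEq_zero_iff_dvd.mpr (dvd_mul_right q e)).add_right h
    rwa [zero_add] at hmod
  · intro e₁ _ _ e₂ _ _ hEq
    have : q * e₁ = q * e₂ := by omega
    exact Nat.eq_of_mul_eq_mul_left hq this
  · intro n hn hne
    obtain ⟨hn1, hmod⟩ := mem_filter.mp hn
    obtain ⟨-, hn1b⟩ := mem_Icc.mp hn1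
    have hhn : h < n := by
      by_contra hle
      apply hne
      rw [Nat.sub_eq_zero_of_le (not_lt.mp hle), ArithmeticFunction.map_zero]
      simp
    obtain ⟨e, he⟩ := (Nat.modEq_iff_dvd' hhn.le).mp hmod.symm
    have hn_eq : n = q * e + h := by omega
    have hepos : 1 ≤ e := by
      rcases Nat.eq_zero_or_pos e with h0 | h0
      · subst h0; simp at he; omega
      · exact h0
    refine ⟨e, mem_Icc.mpr ⟨hepos, ?_⟩, ?_, hn_eq.symm⟩
    · refine (Nat.le_div_iff_mul_le hq).mpr ?_
      nlinarith
    · rw [hn_eq, Nat.add_sub_cancel] at hne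
      exact hne
  · intro e _ _
    rw [Nat.add_sub_cancel]

/-- The multiples of `k²` in `[1, D]` are `k² e`, `e ≤ D / k²`. [folklore] -/
theorem sum_filter_sq_dvd_eq_sum (k D : ℕ) (hk : 1 ≤ k) (F : ℕ → ℝ) :
    ∑ d ∈ (Icc 1 D).filter (fun d : ℕ => k ^ 2 ∣ d), F d =
      ∑ e ∈ Icc 1 (D / k ^ 2), F (k ^ 2 * e) := by
  have hk2 : 0 < k ^ 2 := pow_pos hk 2
  have himg : (Icc 1 D).filter (fun d : ℕ => k ^ 2 ∣ d) =
      (Icc 1 (D / k ^ 2)).image (fun e => k ^ 2 * e) := by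
    ext d
    simp only [mem_filter, mem_Icc, mem_image]
    constructor
    · rintro ⟨⟨hd1, hd2⟩, ⟨e, rfl⟩⟩
      refine ⟨e, ⟨?_, ?_⟩, rfl⟩
      · rcases Nat.eq_zero_or_pos e with h0 | h0
        · subst h0; simp at hd1
        · exact h0
      · exact (Nat.le_div_iff_mul_le hk2).mpr (by rw [mul_comm]; exact hd2)
    · rintro ⟨e, ⟨he1, he2⟩, rfl⟩
      have := (Nat.le_div_iff_mul_le hk2).mp he2
      exact ⟨⟨Nat.mul_pos hk2 he1, by rw [mul_comm]; exact this⟩, dvd_mul_right _ _⟩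
  rw [himg, Finset.sum_image]
  intro e₁ _ e₂ _ hEq
  exact Nat.eq_of_mul_eq_mul_left hk2 hEq

/-- `λ(m)² = 1` for `m ≠ 0` (as real numbers). [folklore] -/
theorem liouville_mul_self_real {m : ℕ} (hm : m ≠ 0) :
    (ArithmeticFunction.liouville m : ℝ) * (ArithmeticFunction.liouville m : ℝ) = 1 := by
  rw [ArithmeticFunction.liouville_apply hm]
  push_cast
  rw [← mul_pow]
  norm_num

/-! ### The `k²`-trick at the single height `X + h` -/

/-- **The `k²`-trick.**  For `m ≥ 1`:
`∑_{d ≤ X/m} μ(d) Λ(dm + h) = λ(m) ∑_{k ≤ X/m} μ(k) T(k² m)` with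
`T(q) = ∑_{n ≤ X + h, n ≡ h (q)} Λ(n) λ(n - h)`: write `μ(d) = λ(d) ∑_{k² ∣ d} μ(k)`, `d = k² e`,
`λ(k² e) = λ(m) λ(k² m e)` and `n = k² m e + h`. [folklore] -/
theorem slice_eq_liouville_mul_sum (h m X : ℕ) (hm : 1 ≤ m) :
    ∑ d ∈ Icc 1 (X / m), (μ d : ℝ) * Λ (d * m + h) =
      (ArithmeticFunction.liouville m : ℝ) * ∑ k ∈ Icc 1 (X / m), (μ k : ℝ) *
        ∑ n ∈ (Icc 1 (X + h)).filter (fun n : ℕ => n ≡ h [MOD k ^ 2 * m]),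
          Λ n * (ArithmeticFunction.liouville (n - h) : ℝ) := by
  have h1 : ∀ d ∈ Icc 1 (X / m), (μ d : ℝ) * Λ (d * m + h) =
      ∑ k ∈ Icc 1 (X / m), if k ^ 2 ∣ d then
        (ArithmeticFunction.liouville d : ℝ) * (μ k : ℝ) * Λ (d * m + h) else 0 := by
    intro d hd
    obtain ⟨hd1, hd2⟩ := mem_Icc.mp hd
    rw [Literature.NumberTheory.LFunctions.moebius_eq_liouville_mul_sqfreeInd d,
      Literature.NumberTheory.LFunctions.sqfreeInd_eq_sum_moebius hd1 hd2, Finset.mul_sum,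
      Finset.sum_mul, Finset.sum_filter]
  rw [Finset.sum_congr rfl h1, Finset.sum_comm, Finset.mul_sum]
  refine Finset.sum_congr rfl fun k hk => ?_
  obtain ⟨hk1, -⟩ := mem_Icc.mp hk
  have hq : 1 ≤ k ^ 2 * m := Nat.mul_pos (pow_pos hk1 2) hm
  rw [← Finset.sum_filter, sum_filter_sq_dvd_eq_sum k (X / m) hk1,
    sum_filter_modEq_eq_sum_cofactor h (k ^ 2 * m) X hq, Finset.mul_sum, Finset.mul_sum]
  have hidx : X / m / k ^ 2 = X / (k ^ 2 * m) := by
    rw [Nat.div_div_eq_div_mul, mul_comm]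
  rw [hidx]
  refine Finset.sum_congr rfl fun e _ => ?_
  have hmul : (ArithmeticFunction.liouville (k ^ 2 * m * e) : ℝ) =
      (ArithmeticFunction.liouville m : ℝ) * (ArithmeticFunction.liouville (k ^ 2 * e) : ℝ) := by
    rw [show k ^ 2 * m * e = m * (k ^ 2 * e) by ring, ArithmeticFunction.liouville_apply_mul]
    push_cast
    ring
  rw [hmul, show k ^ 2 * e * m + h = k ^ 2 * m * e + h by ring]
  have hsq := liouville_mul_self_real (m := m) (by omega)
  linear_combination
    (-((μ k : ℝ) * Λ (k ^ 2 * m * e + h) * (ArithmeticFunction.liouville (k ^ 2 * e) : ℝ))) * hsq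

/-- `|S_m| ≤ ∑_{k ≤ X/m} |T(k² m)|` (`|λ(m)| ≤ 1`, `|μ(k)| ≤ 1`). [folklore] -/
theorem abs_slice_le (h m X : ℕ) (hm : 1 ≤ m) :
    |∑ d ∈ Icc 1 (X / m), (μ d : ℝ) * Λ (d * m + h)| ≤
      ∑ k ∈ Icc 1 (X / m), |∑ n ∈ (Icc 1 (X + h)).filter (fun n : ℕ => n ≡ h [MOD k ^ 2 * m]),
          Λ n * (ArithmeticFunction.liouville (n - h) : ℝ)| := by
  rw [slice_eq_liouville_mul_sum h m X hm, abs_mul]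
  refine (mul_le_mul (Literature.NumberTheory.Sieve.abs_liouville_le_one m)
    (abs_sum_le_sum_abs _ _) (abs_nonneg _) zero_le_one).trans ?_
  rw [one_mul]
  refine sum_le_sum fun k _ => ?_
  rw [abs_mul]
  exact mul_le_of_le_one_left (abs_nonneg _)
    (Literature.NumberTheory.LFunctions.abs_moebius_real_le_one k)

/-- Trivial bound for one class sum: `|T(q)| ≤ (X log(X + h)) / q` for `q ≥ 1`. [folklore] -/
theorem abs_classSum_le (h q X : ℕ) (hq : 1 ≤ q) :
    |∑ n ∈ (Icc 1 (X + h)).filter (fun n : ℕ => n ≡ h [MOD q]),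
        Λ n * (ArithmeticFunction.liouville (n - h) : ℝ)| ≤
      (X : ℝ) * Real.log ((X + h : ℕ) : ℝ) / q := by
  rw [sum_filter_modEq_eq_sum_cofactor h q X hq]
  have hterm : ∀ e ∈ Icc 1 (X / q),
      |Λ (q * e + h) * (ArithmeticFunction.liouville (q * e) : ℝ)| ≤
        Real.log ((X + h : ℕ) : ℝ) := by
    intro e he
    obtain ⟨he1, he2⟩ := mem_Icc.mp he
    have hqe : e * q ≤ X := (Nat.le_div_iff_mul_le hq).mp he2
    have hqe' : 1 ≤ q * e := Nat.mul_pos hq he1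
    rw [abs_mul, abs_of_nonneg ArithmeticFunction.vonMangoldt_nonneg]
    calc Λ (q * e + h) * |(ArithmeticFunction.liouville (q * e) : ℝ)|
        ≤ Λ (q * e + h) * 1 :=
          mul_le_mul_of_nonneg_left (Literature.NumberTheory.Sieve.abs_liouville_le_one _)
            ArithmeticFunction.vonMangoldt_nonneg
      _ = Λ (q * e + h) := mul_one _
      _ ≤ Real.log ((q * e + h : ℕ) : ℝ) := ArithmeticFunction.vonMangoldt_le_log
      _ ≤ Real.log ((X + h : ℕ) : ℝ) :=
          Real.log_le_log (Nat.cast_pos.mpr (by omega)) (Nat.cast_le.mpr (by nlinarith))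
  calc |∑ e ∈ Icc 1 (X / q), Λ (q * e + h) * (ArithmeticFunction.liouville (q * e) : ℝ)|
      ≤ ∑ e ∈ Icc 1 (X / q), |Λ (q * e + h) * (ArithmeticFunction.liouville (q * e) : ℝ)| :=
        abs_sum_le_sum_abs _ _
    _ ≤ ∑ _e ∈ Icc 1 (X / q), Real.log ((X + h : ℕ) : ℝ) := sum_le_sum hterm
    _ = ((X / q : ℕ) : ℝ) * Real.log ((X + h : ℕ) : ℝ) := by
        rw [sum_const, Nat.card_Icc, nsmul_eq_mul, Nat.add_sub_cancel]
    _ ≤ (X : ℝ) / q * Real.log ((X + h : ℕ) : ℝ) :=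
        mul_le_mul_of_nonneg_right Nat.cast_div_le (Real.log_natCast_nonneg _)
    _ = (X : ℝ) * Real.log ((X + h : ℕ) : ℝ) / q := by ring

/-! ### Head and tail for an abstract family `T` with `|T(q)| ≤ A / q` -/

/-- `∑_{K < k ≤ D} 1/k² ≤ 1/K` for `K ≥ 1`. [folklore] -/
theorem sum_Ioc_inv_sq_le_inv (K D : ℕ) (hK : 1 ≤ K) :
    ∑ k ∈ Ioc K D, ((k : ℝ) ^ 2)⁻¹ ≤ (K : ℝ)⁻¹ := by
  rcases le_or_gt K D with hKD | hDK
  · calc ∑ k ∈ Ioc K D, ((k : ℝ) ^ 2)⁻¹ ≤ (K : ℝ)⁻¹ - (D : ℝ)⁻¹ :=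
          sum_Ioc_inv_sq_le_sub (by omega) hKD
      _ ≤ (K : ℝ)⁻¹ := sub_le_self _ (by positivity)
  · rw [Finset.Ioc_eq_empty (by omega), sum_empty]
    positivity

/-- The tail of one slice: if `|T(q)| ≤ A / q` for `q ≥ 1`, then for `m, K ≥ 1`,
`∑_{K < k ≤ D} |T(k² m)| ≤ A / (m K)`. [folklore] -/
theorem tail_le_of_bound (T : ℕ → ℝ) {A : ℝ} (hA : 0 ≤ A)
    (hT : ∀ q : ℕ, 1 ≤ q → |T q| ≤ A / q) (m D K : ℕ) (hm : 1 ≤ m) (hK : 1 ≤ K) :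
    ∑ k ∈ Ioc K D, |T (k ^ 2 * m)| ≤ A / m * (K : ℝ)⁻¹ := by
  have hterm : ∀ k ∈ Ioc K D, |T (k ^ 2 * m)| ≤ A / m * ((k : ℝ) ^ 2)⁻¹ := by
    intro k hk
    obtain ⟨hk1, -⟩ := mem_Ioc.mp hk
    have hkpos : 1 ≤ k := by omega
    refine (hT (k ^ 2 * m) (Nat.mul_pos (pow_pos hkpos 2) hm)).trans (le_of_eq ?_)
    have hk0 : (k : ℝ) ≠ 0 := by positivity
    have hm0 : (m : ℝ) ≠ 0 := by positivity
    push_cast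
    field_simp
  calc ∑ k ∈ Ioc K D, |T (k ^ 2 * m)|
      ≤ ∑ k ∈ Ioc K D, A / m * ((k : ℝ) ^ 2)⁻¹ := sum_le_sum hterm
    _ = A / m * ∑ k ∈ Ioc K D, ((k : ℝ) ^ 2)⁻¹ := by rw [Finset.mul_sum]
    _ ≤ A / m * (K : ℝ)⁻¹ :=
        mul_le_mul_of_nonneg_left (sum_Ioc_inv_sq_le_inv K D hK) (by positivity)

/-- The head, summed over the dilations: for `K² M ≤ Q` and any family `T`,
`∑_{m ≤ M} ∑_{k ≤ K} |T(k² m)| ≤ K ∑_{q ≤ Q} |T(q)|` (for fixed `k` the map `m ↦ k² m` is injective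
into `[1, Q]`). [folklore] -/
theorem head_le_of_sq_mul_le (T : ℕ → ℝ) (M K Q : ℕ) (hKMQ : K ^ 2 * M ≤ Q) :
    ∑ m ∈ Icc 1 M, ∑ k ∈ Icc 1 K, |T (k ^ 2 * m)| ≤ (K : ℝ) * ∑ q ∈ Icc 1 Q, |T q| := by
  rw [Finset.sum_comm]
  have hk : ∀ k ∈ Icc 1 K, ∑ m ∈ Icc 1 M, |T (k ^ 2 * m)| ≤ ∑ q ∈ Icc 1 Q, |T q| := by
    intro k hk
    obtain ⟨hk1, hk2⟩ := mem_Icc.mp hk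
    have hk2pos : 0 < k ^ 2 := pow_pos hk1 2
    have himg : ∑ q ∈ (Icc 1 M).image (fun m : ℕ => k ^ 2 * m), |T q| =
        ∑ m ∈ Icc 1 M, |T (k ^ 2 * m)| :=
      Finset.sum_image fun m₁ _ m₂ _ hEq => Nat.eq_of_mul_eq_mul_left hk2pos hEq
    rw [← himg]
    refine Finset.sum_le_sum_of_subset_of_nonneg ?_ fun _ _ _ => abs_nonneg _
    intro q hq
    obtain ⟨m, hm, rfl⟩ := mem_image.mp hq
    obtain ⟨hm1, hm2⟩ := mem_Icc.mp hm
    refine mem_Icc.mpr ⟨Nat.mul_pos hk2pos hm1, ?_⟩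
    calc k ^ 2 * m ≤ K ^ 2 * M := Nat.mul_le_mul (Nat.pow_le_pow_left hk2 2) hm2
      _ ≤ Q := hKMQ
  calc ∑ k ∈ Icc 1 K, ∑ m ∈ Icc 1 M, |T (k ^ 2 * m)|
      ≤ ∑ _k ∈ Icc 1 K, ∑ q ∈ Icc 1 Q, |T q| := sum_le_sum hk
    _ = (K : ℝ) * ∑ q ∈ Icc 1 Q, |T q| := by
        rw [sum_const, Nat.card_Icc, nsmul_eq_mul, Nat.add_sub_cancel]

/-- **Head + tail, abstract form.**  If `|S(m)| ≤ ∑_{k ≤ D(m)} |T(k² m)|` for `m ≥ 1` and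
`|T(q)| ≤ A / q` for `q ≥ 1` (`A ≥ 0`), then for `K ≥ 1` and `K² M ≤ Q`:
`∑_{m ≤ M} |S(m)| ≤ K ∑_{q ≤ Q} |T(q)| + (A / K) ∑_{m ≤ M} 1/m`. [folklore] -/
theorem sum_abs_le_head_add_tail (S T : ℕ → ℝ) (D : ℕ → ℕ) {A : ℝ} (hA : 0 ≤ A)
    (hS : ∀ m : ℕ, 1 ≤ m → |S m| ≤ ∑ k ∈ Icc 1 (D m), |T (k ^ 2 * m)|)
    (hT : ∀ q : ℕ, 1 ≤ q → |T q| ≤ A / q) (M K Q : ℕ) (hK : 1 ≤ K) (hKMQ : K ^ 2 * M ≤ Q) :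
    ∑ m ∈ Icc 1 M, |S m| ≤
      (K : ℝ) * ∑ q ∈ Icc 1 Q, |T q| + A * (K : ℝ)⁻¹ * ∑ m ∈ Icc 1 M, (m : ℝ)⁻¹ := by
  have hsplit : ∀ m ∈ Icc 1 M, |S m| ≤ ∑ k ∈ Icc 1 K, |T (k ^ 2 * m)| + A / m * (K : ℝ)⁻¹ := by
    intro m hm
    obtain ⟨hm1, -⟩ := mem_Icc.mp hm
    refine (hS m hm1).trans ?_
    have hsub : Icc 1 (D m) ⊆ Icc 1 K ∪ Ioc K (D m) := by
      intro k hk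
      simp only [mem_union, mem_Icc, mem_Ioc] at hk ⊢
      omega
    have hdisj : Disjoint (Icc 1 K) (Ioc K (D m)) := by
      rw [Finset.disjoint_left]
      intro k hk1 hk2
      simp only [mem_Icc, mem_Ioc] at hk1 hk2
      omega
    calc ∑ k ∈ Icc 1 (D m), |T (k ^ 2 * m)|
        ≤ ∑ k ∈ Icc 1 K ∪ Ioc K (D m), |T (k ^ 2 * m)| :=
          sum_le_sum_of_subset_of_nonneg hsub fun _ _ _ => abs_nonneg _
      _ = ∑ k ∈ Icc 1 K, |T (k ^ 2 * m)| + ∑ k ∈ Ioc K (D m), |T (k ^ 2 * m)| :=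
          sum_union hdisj
      _ ≤ _ := by grw [tail_le_of_bound T hA hT m (D m) K hm1 hK]
  calc ∑ m ∈ Icc 1 M, |S m|
      ≤ ∑ m ∈ Icc 1 M, (∑ k ∈ Icc 1 K, |T (k ^ 2 * m)| + A / m * (K : ℝ)⁻¹) := sum_le_sum hsplit
    _ = ∑ m ∈ Icc 1 M, ∑ k ∈ Icc 1 K, |T (k ^ 2 * m)| + ∑ m ∈ Icc 1 M, A / m * (K : ℝ)⁻¹ :=
        sum_add_distrib
    _ ≤ (K : ℝ) * ∑ q ∈ Icc 1 Q, |T q| + ∑ m ∈ Icc 1 M, A / m * (K : ℝ)⁻¹ := by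
        grw [head_le_of_sq_mul_le T M K Q hKMQ]
    _ = _ := by
        congr 1
        rw [Finset.mul_sum]
        exact sum_congr rfl fun m _ => by ring

/-! ### The combinatorial inequality at fixed integer parameters -/

/-- **Head + tail for the slices of `MAvg`.**  For `K ≥ 1` and `K² M ≤ Q`:
`∑_{m ≤ M} |∑_{d ≤ X/m} μ(d) Λ(dm + h)| ≤ K ∑_{q ≤ Q} |T(q)| + (X log(X + h) / K) ∑_{m ≤ M} 1/m`
with `T(q) = ∑_{n ≤ X + h, n ≡ h (q)} Λ(n) λ(n - h)`. [this line] -/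
theorem sum_abs_slice_le (h X M K Q : ℕ) (hK : 1 ≤ K) (hKMQ : K ^ 2 * M ≤ Q) :
    ∑ m ∈ Icc 1 M, |∑ d ∈ Icc 1 (X / m), (μ d : ℝ) * Λ (d * m + h)| ≤
      (K : ℝ) * ∑ q ∈ Icc 1 Q, |∑ n ∈ (Icc 1 (X + h)).filter (fun n : ℕ => n ≡ h [MOD q]),
          Λ n * (ArithmeticFunction.liouville (n - h) : ℝ)| +
        (X : ℝ) * Real.log ((X + h : ℕ) : ℝ) * (K : ℝ)⁻¹ * ∑ m ∈ Icc 1 M, (m : ℝ)⁻¹ :=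
  sum_abs_le_head_add_tail (fun m => ∑ d ∈ Icc 1 (X / m), (μ d : ℝ) * Λ (d * m + h))
    (fun q => ∑ n ∈ (Icc 1 (X + h)).filter (fun n : ℕ => n ≡ h [MOD q]),
      Λ n * (ArithmeticFunction.liouville (n - h) : ℝ))
    (fun m => X / m) (mul_nonneg (Nat.cast_nonneg X) (Real.log_natCast_nonneg _))
    (fun m hm => abs_slice_le h m X hm) (fun q hq => abs_classSum_le h q X hq) M K Q hK hKMQ

/-- Anchor of this helper part (registered sub-goal of `stub_MAvg_of_TAvg`): the tail of
`∑ 1/k²`. [folklore] -/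
theorem mavgOfTAvg_part1_tail_anchor :
    ∀ K D : ℕ, 1 ≤ K → ∑ k ∈ Finset.Ioc K D, ((k : ℝ) ^ 2)⁻¹ ≤ (K : ℝ)⁻¹ :=
  fun K D hK => sum_Ioc_inv_sq_le_inv K D hK

end Summit.Parity.GeneralizedHardyLittlewood.Theorems.EngineToPairs

end
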